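import Summits.ValiantsHypothesis.ValiantsHypothesis.Theorems.LacunarySymmetroidMatrixDescartesCensusDoorA34SheetRankParity
import Summits.ValiantsHypothesis.ValiantsHypothesis.Theorems.LacunarySymmetroidMatrixDescartesCensusDoorA34DefiniteLetter

/-!
# `MatrixDescartes` census — DOOR A at `(3,4)`: the DEFINITE-LETTER LAW ON THE NULL-TOP SHEET — a null-top eighteen with a definite LOWER letter must pass
# a decidable sign test built from the sheet ranks (pair law + propagation law among `S₀,S₁,S₂`, and the TOP TEST against the singular letter's adjugate cell);
# on `(0,4,9,16)` the test fails outright: there a null-top eighteen has three indefinite lower letters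

HONEST FRAMING.  Object-search cell `pub-symmetroid`, engine seat `val-sym-eng-2` (g4); helper rows beside the registered strata line
`Cruxes/DoorA34/Lines/strata.lean` on stmt-ValiantsHypothesis-19980 (`DoorA34 = PosRootLawAt 3 4 18`: OPEN, typed, never asserted here), stub
`stub_nullTopCeiling` (`det S₃ = 0 ⇒ ≤ 17`).  This is door-p3 g14's DEFINITE-LETTER INERTIA LAW (…DoorA34DefiniteLetter, a law about NINETEENS) carried to the
NULL-TOP SHEET with this seat's anatomy/rank-parity rows (…NullTopEighteenAnatomy, …SheetRankParity): a counterexample to the stub on a sorted support is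
Descartes-sharp on the `19` sheet slots, so

* among the LOWER letters `S₀, S₁, S₂` the edge relations are verbatim those of a nineteen with the SHEET rank `ρ` (`Census.edge_parities_of_nullTop_eighteen`):
  `definite_pair_count_sheet` (two definite lower letters: `V_xy = 0` same sign / `3` opposite) and `definite_indefinite_count_sheet` (definite vs non-definite
  lower letter: `V_xy ∈ {1,2}`, by door-p3's `posDef_of_forall_det_add_smul_ne_zero`);
* against the SINGULAR top letter a definite lower letter `S_x` satisfies the TOP TEST `top_test_of_nullTop_eighteen`:
  `W_x := (ρ(3d_x)+ρ(2d_x+d₃)) + (ρ(2d_x+d₃)+ρ(2d₃+d_x))` is EVEN when `adj S₃ ⪰ 0` (the semidefinite inertia cell of `S₃`, and `S₃ ⪰ 0` / `⪯ 0` in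
  particular) and ODD when `−adj S₃ ⪰ 0` (the indefinite cell: `adj S₃ = λ₁λ₂·k̂k̂ᵀ` with `λ₁λ₂ < 0`) — because `det S_x · tr(adj S₃·S_x)` has the sign of the
  adjugate cell (`trace_mul_nonneg_of_posSemidef_posDef`, Schur product) and is non-zero by the anatomy;
* **`card_posRoots_le_17_of_definite_lower_letter_sheet`** — THE LAW: `StrictMono d`, `det S₃ = 0`, an adjugate cell for `S₃`, a definite lower letter `S_a`;
  if no sign assignment `σ` on the lower letters with `σ a ≠ 0` passes [pair law] ∧ [propagation law] ∧ [top test], then `Z₊ ≤ 17` — `stub_nullTopCeiling`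
  HOLDS on that open set;
* **`card_posRoots_le_17_of_definite_lower_letter_on_0_4_9_16`** — on the interleaved support `(0,4,9,16)` (where this seat's exact null-top SIXTEEN lives,
  p623443) the test fails for EVERY lower letter in BOTH adjugate cells (`decide`): a null-top eighteen there has `S₀, S₁, S₂` all indefinite.
  (Located, this seat, same test in Python: also `(0,6,20,29)`, `(0,2,9,12)`, `(0,1,7,11)` both cells; `(0,1,9,12)` and the rail `(0,1,4,N)` in part.)

Nothing here bounds anything on the all-indefinite residue; `DoorA34` and the three stubs stay OPEN; registers unchanged; nothing on `MatrixDescartes`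
(stmt-ValiantsHypothesis-18050) or `VP ≠ VNP` — VP≠VNP not moved.  [folklore] Descartes' rule (sharp case), Schur product theorem, spectral theorem; elementary.
-/

-- `Summit.ValiantsHypothesis.ValiantsHypothesis.…` repeats a component by the D-0017 layout
-- (single-conjunct summit), which the `dupNamespace` linter flags; the name is mandated.
set_option linter.dupNamespace false

namespace Summit.ValiantsHypothesis.ValiantsHypothesis.Theorems.LacunarySymmetroidMatrixDescartes.Census

open Polynomial Finset Matrix
open scoped BigOperators Polynomial Matrix

/-! ## 1. Trace sign against a semidefinite matrix -/

/-- `tr(P Q) ≥ 0` for `P ⪰ 0`, `Q ≻ 0` (Schur: `P ⊙ Q ⪰ 0` at the all-ones vector). [folklore] -/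
theorem trace_mul_nonneg_of_posSemidef_posDef {n : Type*} [Fintype n] [DecidableEq n] {P Q : Matrix n n ℝ}
    (hP : P.PosSemidef) (hQ : Q.PosDef) : 0 ≤ (P * Q).trace := by
  have hpos := (hP.hadamard hQ.posSemidef).dotProduct_mulVec_nonneg (fun _ : n => (1 : ℝ))
  have hQs : ∀ i j, Q j i = Q i j := fun i j => by simpa using hQ.1.apply i j
  have htr : (P * Q).trace = star (fun _ : n => (1 : ℝ)) ⬝ᵥ ((P ⊙ Q) *ᵥ fun _ => 1) := by
    simp only [Matrix.trace, Matrix.diag, Matrix.mul_apply, dotProduct, mulVec, hadamard_apply, Pi.star_apply, star_trivial,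
      mul_one, one_mul]
    exact Finset.sum_congr rfl fun i _ => Finset.sum_congr rfl fun j _ => by rw [hQs i j]
  rw [htr]; exact hpos

/-- **Sign of `det S_x · tr(adj S₃·S_x)` for a DEFINITE `S_x` against a semidefinite ADJUGATE** (`adj S₃ ⪰ 0`): non-negative, hence positive once non-zero. [folklore] -/
theorem det_mul_trace_adjugate_mul_pos_of_definite (T Sx : Matrix (Fin 3) (Fin 3) ℝ) (hx : Sx.PosDef ∨ (-Sx).PosDef)
    (hT : T.adjugate.PosSemidef) (hne : (T.adjugate * Sx).trace ≠ 0) : 0 < Sx.det * (T.adjugate * Sx).trace := by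
  rcases hx with hx | hx
  · have h1 := trace_mul_nonneg_of_posSemidef_posDef hT hx
    exact mul_pos hx.det_pos (lt_of_le_of_ne h1 hne.symm)
  · have h1 := trace_mul_nonneg_of_posSemidef_posDef hT hx
    rw [Matrix.mul_neg, Matrix.trace_neg] at h1
    have h2 : (T.adjugate * Sx).trace < 0 := lt_of_le_of_ne (by linarith) hne
    exact mul_pos_of_neg_of_neg (det_neg_of_neg_posDef hx) h2

/-- … and against a NEGATIVE semidefinite adjugate (`−adj S₃ ⪰ 0`, the indefinite cell of a rank-two `S₃`): negative. [folklore] -/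
theorem det_mul_trace_adjugate_mul_neg_of_definite (T Sx : Matrix (Fin 3) (Fin 3) ℝ) (hx : Sx.PosDef ∨ (-Sx).PosDef)
    (hT : (-T.adjugate).PosSemidef) (hne : (T.adjugate * Sx).trace ≠ 0) : Sx.det * (T.adjugate * Sx).trace < 0 := by
  rcases hx with hx | hx
  · have h1 := trace_mul_nonneg_of_posSemidef_posDef hT hx
    rw [Matrix.neg_mul, Matrix.trace_neg] at h1
    have h2 : (T.adjugate * Sx).trace < 0 := lt_of_le_of_ne (by linarith) hne
    exact mul_neg_of_pos_of_neg hx.det_pos h2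
  · have h1 := trace_mul_nonneg_of_posSemidef_posDef hT hx
    rw [Matrix.neg_mul, Matrix.mul_neg, Matrix.trace_neg, Matrix.trace_neg, neg_neg] at h1
    exact mul_neg_of_neg_of_pos (det_neg_of_neg_posDef hx) (lt_of_le_of_ne h1 hne.symm)

/-! ## 2. The three tests on the sheet -/

/-- **PAIR LAW on the sheet.**  Two DEFINITE lower letters `S_x, S_y` (`x, y ≠ 3`) of a null-top eighteen on a sorted support: `V_xy = 0` if they have the
same sign and `3` otherwise (`ρ` = sheet rank). [folklore] -/
theorem definite_pair_count_sheet (d : Fin 4 → ℕ) (hd : StrictMono d) (S : Fin 4 → Matrix (Fin 3) (Fin 3) ℝ) (h3 : (S 3).det = 0)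
    {x y : Fin 4} (hxy : x ≠ y) (hx3 : x ≠ 3) (hy3 : y ≠ 3)
    (hx : (S x).PosDef ∨ (-S x).PosDef) (hy : (S y).PosDef ∨ (-S y).PosDef)
    (h18 : 18 ≤ ((Matrix.det (∑ l, ((X : ℝ[X]) ^ d l) • (S l).map C)).roots.toFinset.filter (fun t => 0 < t)).card)
    (ρ : ℕ → ℕ) (hρ : ∀ e, ρ e = ((Matrix.det (∑ l, ((X : ℝ[X]) ^ d l) • (S l).map C)).support.filter (· < e)).card) :
    (((S x).PosDef ↔ (S y).PosDef) →
      (ρ (3 * d x) + ρ (2 * d x + d y)) % 2 + (ρ (2 * d x + d y) + ρ (2 * d y + d x)) % 2 + (ρ (2 * d y + d x) + ρ (3 * d y)) % 2 = 0)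
    ∧ (¬ ((S x).PosDef ↔ (S y).PosDef) →
      (ρ (3 * d x) + ρ (2 * d x + d y)) % 2 + (ρ (2 * d x + d y) + ρ (2 * d y + d x)) % 2 + (ρ (2 * d y + d x) + ρ (3 * d y)) % 2 = 3) := by
  obtain ⟨r1, r2, r3⟩ := edge_parities_of_nullTop_eighteen d hd S h3 h18 hxy hx3 hy3 ρ hρ
  rcases hx with hx | hx <;> rcases hy with hy | hy
  · have a0 := hx.det_pos; have a1 := trace_mul_pos_of_posDef (adjugate_posDef_of_posDef hx) hy
    have a2 := trace_mul_pos_of_posDef (adjugate_posDef_of_posDef hy) hx; have a3 := hy.det_pos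
    rw [mod_two_eq_zero_of_rel r1 (mul_pos a0 a1), mod_two_eq_zero_of_rel r2 (mul_pos a1 a2), mod_two_eq_zero_of_rel r3 (mul_pos a2 a3)]
    exact ⟨fun _ => rfl, fun h => absurd (iff_of_true hx hy) h⟩
  · have a0 := hx.det_pos; have a1 := trace_mul_neg_of_posDef_negDef (adjugate_posDef_of_posDef hx) hy
    have a2 := trace_mul_pos_of_posDef (adjugate_posDef_of_neg_posDef hy) hx; have a3 := det_neg_of_neg_posDef hy
    rw [mod_two_eq_one_of_rel r1 (mul_neg_of_pos_of_neg a0 a1), mod_two_eq_one_of_rel r2 (mul_neg_of_neg_of_pos a1 a2),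
      mod_two_eq_one_of_rel r3 (mul_neg_of_pos_of_neg a2 a3)]
    exact ⟨fun h => absurd (h.mp hx) (not_posDef_of_neg_posDef hy), fun _ => rfl⟩
  · have a0 := det_neg_of_neg_posDef hx; have a1 := trace_mul_pos_of_posDef (adjugate_posDef_of_neg_posDef hx) hy
    have a2 := trace_mul_neg_of_posDef_negDef (adjugate_posDef_of_posDef hy) hx; have a3 := hy.det_pos
    rw [mod_two_eq_one_of_rel r1 (mul_neg_of_neg_of_pos a0 a1), mod_two_eq_one_of_rel r2 (mul_neg_of_pos_of_neg a1 a2),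
      mod_two_eq_one_of_rel r3 (mul_neg_of_neg_of_pos a2 a3)]
    exact ⟨fun h => absurd (h.mpr hy) (not_posDef_of_neg_posDef hx), fun _ => rfl⟩
  · have a0 := det_neg_of_neg_posDef hx; have a1 := trace_mul_neg_of_posDef_negDef (adjugate_posDef_of_neg_posDef hx) hy
    have a2 := trace_mul_neg_of_posDef_negDef (adjugate_posDef_of_neg_posDef hy) hx; have a3 := det_neg_of_neg_posDef hy
    rw [mod_two_eq_zero_of_rel r1 (mul_pos_of_neg_of_neg a0 a1), mod_two_eq_zero_of_rel r2 (mul_pos_of_neg_of_neg a1 a2),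
      mod_two_eq_zero_of_rel r3 (mul_pos_of_neg_of_neg a2 a3)]
    exact ⟨fun _ => rfl, fun h => absurd (iff_of_false (not_posDef_of_neg_posDef hx) (not_posDef_of_neg_posDef hy)) h⟩

/-- **PROPAGATION LAW on the sheet.**  A DEFINITE lower letter `S_x` and a lower letter `S_y` (`x, y ≠ 3`) that is neither positive nor negative
definite: `V_xy ∈ {1, 2}`. [folklore] -/
theorem definite_indefinite_count_sheet (d : Fin 4 → ℕ) (hd : StrictMono d) (S : Fin 4 → Matrix (Fin 3) (Fin 3) ℝ) (hS : ∀ l, (S l).IsSymm)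
    (h3 : (S 3).det = 0) {x y : Fin 4} (hxy : x ≠ y) (hx3 : x ≠ 3) (hy3 : y ≠ 3)
    (hx : (S x).PosDef ∨ (-S x).PosDef) (hy : ¬ (S y).PosDef) (hy' : ¬ (-S y).PosDef)
    (h18 : 18 ≤ ((Matrix.det (∑ l, ((X : ℝ[X]) ^ d l) • (S l).map C)).roots.toFinset.filter (fun t => 0 < t)).card)
    (ρ : ℕ → ℕ) (hρ : ∀ e, ρ e = ((Matrix.det (∑ l, ((X : ℝ[X]) ^ d l) • (S l).map C)).support.filter (· < e)).card) :
    (ρ (3 * d x) + ρ (2 * d x + d y)) % 2 + (ρ (2 * d x + d y) + ρ (2 * d y + d x)) % 2 + (ρ (2 * d y + d x) + ρ (3 * d y)) % 2 ≠ 0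
    ∧ (ρ (3 * d x) + ρ (2 * d x + d y)) % 2 + (ρ (2 * d x + d y) + ρ (2 * d y + d x)) % 2 + (ρ (2 * d y + d x) + ρ (3 * d y)) % 2
      ≠ 3 := by
  obtain ⟨r1, r2, r3⟩ := edge_parities_of_nullTop_eighteen d hd S h3 h18 hxy hx3 hy3 ρ hρ
  have hdx := det_letter_ne_zero_of_nullTop_eighteen d hd S h3 h18 x hx3
  have hdy := det_letter_ne_zero_of_nullTop_eighteen d hd S h3 h18 y hy3
  have hHy : (S y).IsHermitian := by unfold Matrix.IsHermitian; rw [conjTranspose_eq_transpose_of_trivial]; exact hS y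
  have hHy' : (-S y).IsHermitian := hHy.neg
  have hdy' : (-S y).det ≠ 0 := by rw [Matrix.det_neg]; simpa using hdy
  have cub : ∀ t : ℝ, (S x + t • S y).det
      = (S x).det + ((S x).adjugate * S y).trace * t + ((S y).adjugate * S x).trace * t ^ 2 + (S y).det * t ^ 3 :=
    fun t => by rw [det_add_smul_fin_three]; ring
  have cub' : ∀ t : ℝ, (S x + t • (-S y)).det
      = (S x).det + (-((S x).adjugate * S y).trace) * t + ((S y).adjugate * S x).trace * t ^ 2 + (-(S y).det) * t ^ 3 := by
    intro t; rw [smul_neg, ← neg_smul, det_add_smul_fin_three]; ring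
  have negx : ∀ (t : ℝ) (B : Matrix (Fin 3) (Fin 3) ℝ), (-S x + t • B).det = -((S x + t • (-B)).det) := by
    intro t B
    rw [show -S x + t • B = -(S x + t • (-B)) by rw [smul_neg, neg_add, neg_neg], Matrix.det_neg, Fintype.card_fin]
    ring
  constructor
  · intro h0
    rcases mod_two_of_neg_one_pow_mul_pos r1 with ⟨p1, w1⟩ | ⟨p1, w1⟩ <;>
    rcases mod_two_of_neg_one_pow_mul_pos r2 with ⟨p2, w2⟩ | ⟨p2, w2⟩ <;>
    rcases mod_two_of_neg_one_pow_mul_pos r3 with ⟨p3, w3⟩ | ⟨p3, w3⟩ <;> (try omega)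
    have hne : ∀ t : ℝ, 0 < t → (S x + t • S y).det ≠ 0 := fun t ht => by
      rw [cub]; exact cubic_ne_zero_of_same_sign ht hdx w1 w2 w3
    rcases hx with hx | hx
    · exact hy (posDef_of_forall_det_add_smul_ne_zero hx hHy hdy hne)
    · refine hy' (posDef_of_forall_det_add_smul_ne_zero hx hHy' hdy' fun t ht => ?_)
      rw [negx, neg_neg]; exact neg_ne_zero.mpr (hne t ht)
  · intro h3'
    rcases mod_two_of_neg_one_pow_mul_pos r1 with ⟨p1, w1⟩ | ⟨p1, w1⟩ <;>
    rcases mod_two_of_neg_one_pow_mul_pos r2 with ⟨p2, w2⟩ | ⟨p2, w2⟩ <;>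
    rcases mod_two_of_neg_one_pow_mul_pos r3 with ⟨p3, w3⟩ | ⟨p3, w3⟩ <;> (try omega)
    have hne : ∀ t : ℝ, 0 < t → (S x + t • (-S y)).det ≠ 0 := fun t ht => by
      rw [cub']; exact cubic_ne_zero_of_same_sign ht hdx (by nlinarith) (by nlinarith) (by nlinarith)
    rcases hx with hx | hx
    · exact hy' (posDef_of_forall_det_add_smul_ne_zero hx hHy' hdy' hne)
    · refine hy (posDef_of_forall_det_add_smul_ne_zero hx hHy hdy fun t ht => ?_)
      rw [negx]; simpa using hne t ht

/-- **TOP TEST on the sheet.**  A DEFINITE lower letter `S_x` (`x ≠ 3`) of a null-top eighteen on a sorted support: the sum of the two half-edge rank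
parities `(ρ(3d_x)+ρ(2d_x+d₃)) % 2 + (ρ(2d_x+d₃)+ρ(2d₃+d_x)) % 2` is EVEN (`0` or `2`) when `adj S₃ ⪰ 0` and ODD (`= 1`) when `−adj S₃ ⪰ 0`. [folklore] -/
theorem top_test_of_nullTop_eighteen (d : Fin 4 → ℕ) (hd : StrictMono d) (S : Fin 4 → Matrix (Fin 3) (Fin 3) ℝ) (h3 : (S 3).det = 0)
    {x : Fin 4} (hx3 : x ≠ 3) (hx : (S x).PosDef ∨ (-S x).PosDef)
    (h18 : 18 ≤ ((Matrix.det (∑ l, ((X : ℝ[X]) ^ d l) • (S l).map C)).roots.toFinset.filter (fun t => 0 < t)).card)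
    (ρ : ℕ → ℕ) (hρ : ∀ e, ρ e = ((Matrix.det (∑ l, ((X : ℝ[X]) ^ d l) • (S l).map C)).support.filter (· < e)).card) :
    ((S 3).adjugate.PosSemidef →
      (ρ (3 * d x) + ρ (2 * d x + d 3)) % 2 + (ρ (2 * d x + d 3) + ρ (2 * d 3 + d x)) % 2 ≠ 1)
    ∧ ((-(S 3).adjugate).PosSemidef →
      (ρ (3 * d x) + ρ (2 * d x + d 3)) % 2 + (ρ (2 * d x + d 3) + ρ (2 * d 3 + d x)) % 2 = 1) := by
  obtain ⟨r1, r2⟩ := halfEdge_parities_of_nullTop_eighteen d hd S h3 h18 hx3 ρ hρ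
  have hA : ((S x).adjugate * S 3).trace ≠ 0 := trace_adjugate_mul_ne_zero_of_nullTop_eighteen d hd S h3 h18 x 3 hx3
  have hB : ((S 3).adjugate * S x).trace ≠ 0 := trace_adjugate_mul_ne_zero_of_nullTop_eighteen d hd S h3 h18 3 x (Ne.symm hx3)
  have hA2 : 0 < ((S x).adjugate * S 3).trace * ((S x).adjugate * S 3).trace := mul_self_pos.mpr hA
  have key : ((S x).det * ((S x).adjugate * S 3).trace) * (((S x).adjugate * S 3).trace * ((S 3).adjugate * S x).trace)
      = ((S x).det * ((S 3).adjugate * S x).trace) * (((S x).adjugate * S 3).trace * ((S x).adjugate * S 3).trace) := by ring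
  constructor
  · intro hcell h1
    have hpos := det_mul_trace_adjugate_mul_pos_of_definite (S 3) (S x) hx hcell hB
    rcases mod_two_of_neg_one_pow_mul_pos r1 with ⟨p1, w1⟩ | ⟨p1, w1⟩ <;>
    rcases mod_two_of_neg_one_pow_mul_pos r2 with ⟨p2, w2⟩ | ⟨p2, w2⟩
    · omega
    · have : ((S x).det * ((S x).adjugate * S 3).trace) * (((S x).adjugate * S 3).trace * ((S 3).adjugate * S x).trace) < 0 :=
        mul_neg_of_pos_of_neg w1 w2
      rw [key] at this; nlinarith [mul_pos hpos hA2]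
    · have : ((S x).det * ((S x).adjugate * S 3).trace) * (((S x).adjugate * S 3).trace * ((S 3).adjugate * S x).trace) < 0 :=
        mul_neg_of_neg_of_pos w1 w2
      rw [key] at this; nlinarith [mul_pos hpos hA2]
    · omega
  · intro hcell
    have hneg := det_mul_trace_adjugate_mul_neg_of_definite (S 3) (S x) hx hcell hB
    rcases mod_two_of_neg_one_pow_mul_pos r1 with ⟨p1, w1⟩ | ⟨p1, w1⟩ <;>
    rcases mod_two_of_neg_one_pow_mul_pos r2 with ⟨p2, w2⟩ | ⟨p2, w2⟩
    · have : 0 < ((S x).det * ((S x).adjugate * S 3).trace) * (((S x).adjugate * S 3).trace * ((S 3).adjugate * S x).trace) :=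
        mul_pos w1 w2
      rw [key] at this; nlinarith [mul_neg_of_neg_of_pos hneg hA2]
    · omega
    · omega
    · have : 0 < ((S x).det * ((S x).adjugate * S 3).trace) * (((S x).adjugate * S 3).trace * ((S 3).adjugate * S x).trace) :=
        mul_pos_of_neg_of_neg w1 w2
      rw [key] at this; nlinarith [mul_neg_of_neg_of_pos hneg hA2]

/-! ## 3. The law -/

/-- **DEFINITE-LETTER LAW ON THE NULL-TOP SHEET (all sorted supports, decidable test).**  Let `d` be strictly increasing, `det S₃ = 0`, and let the
singular top letter have an ADJUGATE CELL `c` (`c = 0`: `adj S₃ ⪰ 0`; `c = 1`: `−adj S₃ ⪰ 0`).  Let `ρ` be the SHEET rank (`ρ(e) = #{sheet exponents < e}`,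
computable from `d`), `V x y` the number of odd consecutive rank sums on the lower edge `{x,y}` and `W x` the number of odd ones on the half-edge `{x,3}`.  If
some LOWER letter `S_a` is definite and NO sign assignment `σ` on the lower letters with `σ a ≠ 0` satisfies [pair law: `V x y = 3·[σ x ≠ σ y]` for `σ x, σ y ≠ 0`]
∧ [propagation: `V x y ∈ {1,2}` for `σ x ≠ 0 = σ y`] ∧ [top test: `W x % 2 = c` for `σ x ≠ 0`, `x ≠ 3`], then `Z₊ ≤ 17`. [folklore] -/
theorem card_posRoots_le_17_of_definite_lower_letter_sheet (d : Fin 4 → ℕ) (hd : StrictMono d) (S : Fin 4 → Matrix (Fin 3) (Fin 3) ℝ)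
    (hS : ∀ l, (S l).IsSymm) (h3 : (S 3).det = 0) (c : ℕ)
    (hcell : ((S 3).adjugate.PosSemidef ∧ c = 0) ∨ ((-(S 3).adjugate).PosSemidef ∧ c = 1))
    (a : Fin 4) (ha : (S a).PosDef ∨ (-S a).PosDef)
    (ρ : ℕ → ℕ) (hρ : ∀ e, ρ e = ((((Finset.univ : Finset (Sym (Fin 4) 3)).erase (Sym.replicate 3 3)).image
          (fun s : Sym (Fin 4) 3 => ((s : Multiset (Fin 4)).map d).sum)).filter (· < e)).card)
    (V : Fin 4 → Fin 4 → ℕ)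
    (hV : ∀ x y : Fin 4, x ≠ y → V x y = (ρ (3 * d x) + ρ (2 * d x + d y)) % 2
        + (ρ (2 * d x + d y) + ρ (2 * d y + d x)) % 2 + (ρ (2 * d y + d x) + ρ (3 * d y)) % 2)
    (W : Fin 4 → ℕ) (hW : ∀ x : Fin 4, W x = (ρ (3 * d x) + ρ (2 * d x + d 3)) % 2 + (ρ (2 * d x + d 3) + ρ (2 * d 3 + d x)) % 2)
    (htest : ∀ σ : Fin 4 → SignType, σ a ≠ 0 →
        (∀ x y : Fin 4, x ≠ y → x ≠ 3 → y ≠ 3 → σ x ≠ 0 → σ y ≠ 0 → V x y = if σ x = σ y then 0 else 3) →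
        (∀ x y : Fin 4, x ≠ y → x ≠ 3 → y ≠ 3 → σ x ≠ 0 → σ y = 0 → V x y ≠ 0 ∧ V x y ≠ 3) →
        (∀ x : Fin 4, x ≠ 3 → σ x ≠ 0 → W x % 2 = c) → False) :
    ((Matrix.det (∑ l, ((X : ℝ[X]) ^ d l) • (S l).map C)).roots.toFinset.filter (fun t => 0 < t)).card ≤ 17 := by
  classical
  by_contra hlt; push Not at hlt
  have h18 : 18 ≤ ((Matrix.det (∑ l, ((X : ℝ[X]) ^ d l) • (S l).map C)).roots.toFinset.filter (fun t => 0 < t)).card := by omega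
  have hρ' : ∀ e, ρ e = ((Matrix.det (∑ l, ((X : ℝ[X]) ^ d l) • (S l).map C)).support.filter (· < e)).card := fun e => by
    rw [hρ, sheetRank_eq_of_nullTop_eighteen d S h3 h18]
  let σ : Fin 4 → SignType := fun x => if (S x).PosDef then 1 else if (-S x).PosDef then -1 else 0
  have hσdef : ∀ x, σ x ≠ 0 → (S x).PosDef ∨ (-S x).PosDef := fun x hx => by
    by_contra h; push Not at h; exact hx (by simp [σ, h.1, h.2])
  have hσpos : ∀ x, (S x).PosDef → σ x = 1 := fun x hx => by simp [σ, hx]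
  have hσneg : ∀ x, (-S x).PosDef → σ x = -1 := fun x hx => by
    have hnx : ¬ (S x).PosDef := not_posDef_of_neg_posDef hx; simp [σ, hx, hnx]
  refine htest σ ?_ ?_ ?_ ?_
  · rcases ha with ha | ha
    · rw [hσpos a ha]; decide
    · rw [hσneg a ha]; decide
  · intro x y hxy hx3 hy3 hx hy
    have hx' := hσdef x hx; have hy' := hσdef y hy
    obtain ⟨hsame, hdiff⟩ := definite_pair_count_sheet d hd S h3 hxy hx3 hy3 hx' hy' h18 ρ hρ'
    rw [hV x y hxy]
    rcases hx' with hx' | hx' <;> rcases hy' with hy' | hy'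
    · rw [hsame (iff_of_true hx' hy'), hσpos x hx', hσpos y hy']; decide
    · rw [hdiff (fun h => not_posDef_of_neg_posDef hy' (h.mp hx')), hσpos x hx', hσneg y hy']; decide
    · rw [hdiff (fun h => not_posDef_of_neg_posDef hx' (h.mpr hy')), hσneg x hx', hσpos y hy']; decide
    · rw [hsame (iff_of_false (not_posDef_of_neg_posDef hx') (not_posDef_of_neg_posDef hy')), hσneg x hx', hσneg y hy']
      decide
  · intro x y hxy hx3 hy3 hx hy
    have hx' := hσdef x hx
    have hny : ¬ (S y).PosDef := fun h => by rw [hσpos y h] at hy; exact absurd hy (by decide)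
    have hny' : ¬ (-S y).PosDef := fun h => by rw [hσneg y h] at hy; exact absurd hy (by decide)
    rw [hV x y hxy]
    exact definite_indefinite_count_sheet d hd S hS h3 hxy hx3 hy3 hx' hny hny' h18 ρ hρ'
  · intro x hx3 hx
    have hx' := hσdef x hx
    obtain ⟨t0, t1⟩ := top_test_of_nullTop_eighteen d hd S h3 hx3 hx' h18 ρ hρ'
    rw [hW x]
    have b1 := Nat.mod_lt (ρ (3 * d x) + ρ (2 * d x + d 3)) (show 0 < 2 by norm_num)
    have b2 := Nat.mod_lt (ρ (2 * d x + d 3) + ρ (2 * d 3 + d x)) (show 0 < 2 by norm_num)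
    rcases hcell with ⟨hpsd, hc⟩ | ⟨hnsd, hc⟩
    · have := t0 hpsd; subst hc; omega
    · have := t1 hnsd; subst hc; omega

/-! ## 4. Instance: the interleaved support `(0,4,9,16)` -/

/-- The `19` sheet exponents of `(0,4,9,16)`. [folklore] -/
theorem sheetExponents_0_4_9_16 :
    (((Finset.univ : Finset (Sym (Fin 4) 3)).erase (Sym.replicate 3 3)).image
        (fun s : Sym (Fin 4) 3 => ((s : Multiset (Fin 4)).map (![0, 4, 9, 16] : Fin 4 → ℕ)).sum))
      = ({0, 4, 8, 9, 12, 13, 16, 17, 18, 20, 22, 24, 25, 27, 29, 32, 34, 36, 41} : Finset ℕ) := by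
  decide

set_option synthInstance.maxSize 2048 in
set_option synthInstance.maxHeartbeats 400000 in
/-- **`(0,4,9,16)`: a null-top eighteen has three INDEFINITE lower letters.**  On the support `(0,4,9,16)` (where the kernel's interleaved null-top SIXTEEN
`Census.NullTopSixteen04916` lives), a real symmetric pencil with `det S₃ = 0`, an adjugate cell for `S₃`, and a DEFINITE lower letter has at most `17`
distinct positive determinant roots — the test of `card_posRoots_le_17_of_definite_lower_letter_sheet` fails for every lower letter in both cells (`decide`).
[folklore] -/
theorem card_posRoots_le_17_of_definite_lower_letter_on_0_4_9_16 (S : Fin 4 → Matrix (Fin 3) (Fin 3) ℝ) (hS : ∀ l, (S l).IsSymm)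
    (h3 : (S 3).det = 0) (hcell : (S 3).adjugate.PosSemidef ∨ (-(S 3).adjugate).PosSemidef)
    (a : Fin 4) (ha3 : a ≠ 3) (ha : (S a).PosDef ∨ (-S a).PosDef) :
    ((Matrix.det (∑ l, ((X : ℝ[X]) ^ ((![0, 4, 9, 16] : Fin 4 → ℕ)) l) • (S l).map C)).roots.toFinset.filter (fun t => 0 < t)).card
      ≤ 17 := by
  have hd : StrictMono (![0, 4, 9, 16] : Fin 4 → ℕ) := by
    refine Fin.strictMono_iff_lt_succ.2 fun j => ?_
    fin_cases j <;> decide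
  rcases hcell with hcell | hcell
  · refine card_posRoots_le_17_of_definite_lower_letter_sheet _ hd S hS h3 0 (Or.inl ⟨hcell, rfl⟩) a ha
      (fun e => ((({0, 4, 8, 9, 12, 13, 16, 17, 18, 20, 22, 24, 25, 27, 29, 32, 34, 36, 41} : Finset ℕ)).filter (· < e)).card)
      (fun e => by rw [sheetExponents_0_4_9_16]) (![![0, 2, 3, 1], ![2, 0, 3, 1], ![3, 3, 0, 2], ![1, 1, 2, 0]]) (by decide)
      (![1, 1, 1, 0]) (by decide) ?_
    clear ha hcell; revert ha3 a; decide
  · refine card_posRoots_le_17_of_definite_lower_letter_sheet _ hd S hS h3 1 (Or.inr ⟨hcell, rfl⟩) a ha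
      (fun e => ((({0, 4, 8, 9, 12, 13, 16, 17, 18, 20, 22, 24, 25, 27, 29, 32, 34, 36, 41} : Finset ℕ)).filter (· < e)).card)
      (fun e => by rw [sheetExponents_0_4_9_16]) (![![0, 2, 3, 1], ![2, 0, 3, 1], ![3, 3, 0, 2], ![1, 1, 2, 0]]) (by decide)
      (![1, 1, 1, 0]) (by decide) ?_
    clear ha hcell; revert ha3 a; decide

end Summit.ValiantsHypothesis.ValiantsHypothesis.Theorems.LacunarySymmetroidMatrixDescartes.Census
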